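import Literature.NumberTheory.LFunctions.DeuringPhenomenonElementaryTheoremTwoProofs
import Mathlib.Analysis.SumIntegralComparisons
import HarnessLib

/-!
# Bellotti–Puglisi's Lemmas 5–6 deep in the strip: the multiplicative chain
# `Σ_{n≤N} g(n) n^{−s} ≈ V · ∏_{p∣D}(1 + p^{−s})`, `V ≈ ζ(2s)`, for every `½ < σ ≤ 1`

Topic `Literature/NumberTheory/LFunctions` (namespace `Literature.NumberTheory.LFunctions`, helpers in the
grouping sub-namespace `BellottiPuglisi2023`). PROOF LAYER (theorems only; no definition, no named fact):
the third tool towards the named facts `bellottiPuglisi2023_theorem1` / `_corollary1` of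
`ElementaryDeuringHeilbronnPhenomenon.lean` (cell `parity-realchar`, SIEGEL INSTRUMENT, conditionals
column, the Deuring direction). Source: C. Bellotti, G. Puglisi, Acta Arith. **208** (2023) 257–277 =
arXiv:2201.03990v3, §2, Lemmas 5–6 (pp. 9–10) — Pintz's part III §4 skeleton (tree:
`Pintz1976Deuring.sum_eq_sum_free_mul_sum_split` (4.20), `sum_free_eq_sum_kernel_mul_sum_sq` (4.21),
PROVED in `DeuringPhenomenonElementaryTheoremTwoProofs.lean`) run at `σ ≥ ½ + ℓ` instead of `σ ≥ ¾`.

PRINT (pp. 9–10; `A_j = {n : p ∣ n ⇒ χ(p) = j}`, `R = {bm : b ∈ A₀, m ∈ A_{−1}}`): "**Lemma 5.** If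
`σ ≥ ½ + ℓ` and […] `h(−q) ≤ log q/(log log q)^η` […] then `Σ_{n≤q} g(n)n^{−s} = Σ_{r∈R,r≤q} g(r)r^{−s} +
O(exp{−(1/16)(log log q)^η})`. *Proof.* `Σ_{n≤q} g(n)n^{−s} = Σ_{r∈R,r≤q} g(r)r^{−s} +
O(Σ_{r∈R,r≤q} g(r)r^{−σ} Σ_{a∈A₁,1<a≤q} g(a)a^{−σ})` and `Σ_{r∈R,r≤q} g(r)r^{−σ} ≤ Σ_{b∈A₀} μ²(b)
b^{−½−ℓ} Σ_{k≥1} k^{−1−2ℓ} ≪ (1/ℓ) exp(Σ_{p∣q} 1/√p)` […]. **Lemma 6.** […] `Σ_{r∈R,r≤q} g(r)r^{−s} =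
ζ(2s)∏_{p∣q}(1 + p^{−s})[1 + O(exp{−⅓(log log q)^{η−μ}})] + O(exp{−½ log q/(log log q)^μ})`. *Proof.*
[…] if `n ∉ R` then `n > R₀`. It follows that `Σ_{r∈R,r≤q} g(r)r^{−s} = Σ_{h∣q} μ²(h)h^{−s}
Σ_{r∈R, r≤√(q/h)} r^{−2s} = Σ_{h∣q} μ²(h) h^{−s} [ζ(2s) + O(Σ_{r>R₀} r^{−1−2ℓ})] +
O(Σ_{h∣q} μ²(h) h^{−½−ℓ} Σ_{r>√(q/h)} r^{−1−2ℓ})` […]".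

HERE, uniformly and without the class-number hypothesis (which enters only through `R` = a bound below
every split prime, and through `ω(D)`), for a quadratic `χ` mod `D`, `½ < σ = Re s ≤ 1`, `N ≥ D`,
`1 ≤ R ≤ N` with every split prime `> R` (`BellottiPuglisi2023.chain`): there is a number `V` (the
common truncation `Σ_{l≤N, l∈R} l^{−2s}` of `ζ(2s)`) with
`‖V − ζ(2s)‖ ≤ R^{1−2σ}/(2σ−1)` and
`‖Σ_{n≤N} g(n)n^{−s} − V·∏_{p∣D}(1 + p^{−s})‖ ≤ 2^{ω(D)}·((1 + 1/(2σ−1))·W + 2N^{½−σ}/(2σ−1))`,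
`W = Σ_{1<a≤N, a∈A₁} g(a)a^{−σ}`. The point of isolating `V` (a refinement of the print, whose
"`Σ_h μ²(h)h^{−s}[ζ(2s) + O(T)] = ∏(1+p^{−s})[ζ(2s) + O(T)]`" silently treats a `b`-independent error):
the `R`-tail error is then RELATIVE to `∏(1+p^{−s})` exactly, and only the truncation error
`N^{½−σ}`, which is exponentially small in the application, carries the divisor factor `2^{ω(D)}`.
Tools: `sum_Ioc_rpow_neg_le` (`Σ_{R<n≤M} n^{−a} ≤ R^{1−a}/(a−1)`, integral comparison),
`norm_sum_sq_sub_zeta_le'` ((4.22) at `σ > ½`), `sum_kernel_eq_prod'` (the kernel sum is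
`∏_{p∣D}(1 + w(p))`), and, inside `chain`, `Σ_{r∈R, r≤N} g(r)r^{−σ} ≤ 2^{ω(D)}(1 + 1/(2σ−1))` via
(4.21) at the real point `σ`.

LABEL (cell rule): instrument / proof layer (kernel). WHAT THIS IS NOT: nothing here assumes a zero of
`ζ` or a small class number; nothing here bears on parity.

## References

* [BellottiPuglisi2023] Acta Arith. 208 (2023) 257–277 = arXiv:2201.03990v3, §2 Lemmas 5–6 pp. 9–10.
* [Pintz1976ElementaryIII] J. Pintz, Acta Arith. 31 (1976) 295–306, §4 (4.15)–(4.23) (the skeleton).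
-/

noncomputable section

open Complex Finset Filter Topology ArithmeticFunction

namespace Literature.NumberTheory.LFunctions

namespace BellottiPuglisi2023

open RealChar Pintz1976Deuring DirichletAbel

/-! ### Analytic helpers at `σ > ½` -/

section Helpers

/-- For a prime `p` and `σ > 0`: `0 ≤ p^{−σ} < 1`. [folklore] -/
private theorem prime_rpow_neg_lt_one {p : ℕ} (hp : p.Prime) {σ : ℝ} (hσ : 0 < σ) :
    0 ≤ (p : ℝ) ^ (-σ) ∧ (p : ℝ) ^ (-σ) < 1 := by
  have hp1 : (1 : ℝ) < p := by exact_mod_cast hp.one_lt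
  refine ⟨Real.rpow_nonneg (by linarith) _, ?_⟩
  rw [Real.rpow_neg (by linarith)]
  exact inv_lt_one_of_one_lt₀ (Real.one_lt_rpow hp1 hσ)

/-- For a prime `p` and `σ ≥ ½`: `p^{−σ} ≤ 3/4` (`2^{−1/2} ≤ 3/4`). [folklore] -/
private theorem prime_rpow_neg_le_three_quarters {p : ℕ} (hp : p.Prime) {σ : ℝ} (hσ : 1 / 2 ≤ σ) :
    (p : ℝ) ^ (-σ) ≤ 3 / 4 := by
  have hp2 : (2 : ℝ) ≤ p := by exact_mod_cast hp.two_le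
  have h1 : (p : ℝ) ^ (-σ) ≤ (2 : ℝ) ^ (-σ) := Real.rpow_le_rpow_of_nonpos (by norm_num) hp2 (by linarith)
  have h2 : (2 : ℝ) ^ (-σ) ≤ (2 : ℝ) ^ (-(1 / 2) : ℝ) :=
    Real.rpow_le_rpow_of_exponent_le (by norm_num) (by linarith)
  have h3 : (2 : ℝ) ^ (-(1 / 2) : ℝ) ≤ 3 / 4 := by
    have h4 : ((2 : ℝ) ^ (-(1 / 2) : ℝ)) ^ 2 = 1 / 2 := by
      rw [← Real.rpow_natCast, ← Real.rpow_mul (by norm_num)]; norm_num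
    have h0 : 0 ≤ (2 : ℝ) ^ (-(1 / 2) : ℝ) := Real.rpow_nonneg (by norm_num) _
    nlinarith
  exact h1.trans (h2.trans h3)

/-- **`Σ_{R < n ≤ M} n^{−a} ≤ R^{1−a}/(a−1)`** for `a > 1`, `R ≥ 1` (comparison with
`∫_R^M x^{−a} dx`) — the tail `Σ_{r > R₀} r^{−1−2ℓ} ≪ R₀^{−2ℓ}/ℓ` of the proof of Lemma 6.
[cite: BellottiPuglisi2023, §2 proof of Lemma 6 p. 10] -/
theorem sum_Ioc_rpow_neg_le {a : ℝ} (ha : 1 < a) {R : ℕ} (hR : 1 ≤ R) (M : ℕ) :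
    ∑ n ∈ Ioc R M, (n : ℝ) ^ (-a) ≤ (R : ℝ) ^ (1 - a) / (a - 1) := by
  have hR0 : (0 : ℝ) < R := by exact_mod_cast hR
  have hRa : 0 ≤ (R : ℝ) ^ (1 - a) / (a - 1) := div_nonneg (Real.rpow_nonneg hR0.le _) (by linarith)
  rcases le_or_gt M R with hMR | hMR
  · rw [Finset.Ioc_eq_empty (by omega), Finset.sum_empty]; exact hRa
  -- shift the index and compare with the integral
  have hshift : ∑ n ∈ Ioc R M, (n : ℝ) ^ (-a) = ∑ i ∈ Ico R M, (((i + 1 : ℕ)) : ℝ) ^ (-a) := by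
    have h := Finset.sum_Ico_add' (fun n : ℕ => (n : ℝ) ^ (-a)) R M 1
    rw [Finset.Ico_add_one_add_one_eq_Ioc] at h
    exact h.symm
  have hanti : AntitoneOn (fun x : ℝ => x ^ (-a)) (Set.Icc (R : ℝ) M) := by
    intro x hx y _ hxy
    exact Real.rpow_le_rpow_of_nonpos (lt_of_lt_of_le hR0 hx.1) hxy (by linarith)
  have hint := AntitoneOn.sum_le_integral_Ico hMR.le hanti
  have hM0 : (0 : ℝ) < M := lt_trans hR0 (by exact_mod_cast hMR)
  have hval : ∫ x in (R : ℝ)..M, x ^ (-a) = ((M : ℝ) ^ (-a + 1) - (R : ℝ) ^ (-a + 1)) / (-a + 1) :=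
    integral_rpow (Or.inr ⟨ne_of_lt (by linarith), Set.notMem_uIcc_of_lt hR0 hM0⟩)
  rw [hshift]
  refine hint.trans ?_
  rw [hval]
  have hM1 : 0 ≤ (M : ℝ) ^ (-a + 1) := Real.rpow_nonneg hM0.le _
  have e : ((M : ℝ) ^ (-a + 1) - (R : ℝ) ^ (-a + 1)) / (-a + 1) =
      ((R : ℝ) ^ (1 - a) - (M : ℝ) ^ (-a + 1)) / (a - 1) := by
    rw [show (1 - a) = -a + 1 by ring]
    field_simp [(by linarith : (a - 1) ≠ 0), (by linarith : (-a + 1) ≠ 0)]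
    ring
  rw [e]
  exact div_le_div_of_nonneg_right (by linarith) (by linarith)

/-- `Σ_{n ≤ M} n^{−2σ} ≤ 1 + 1/(2σ − 1)` for `σ > ½` (any `M`) — the proof of Lemma 5's
"`Σ_{k≥1} k^{−1−2ℓ} ≪ 1/ℓ`". [cite: BellottiPuglisi2023, §2 proof of Lemma 5 p. 9] -/
theorem sum_Ioc_zero_rpow_neg_le {σ : ℝ} (hσ : 1 / 2 < σ) (M : ℕ) :
    ∑ n ∈ Ioc 0 M, (n : ℝ) ^ (-(2 * σ)) ≤ 1 + 1 / (2 * σ - 1) := by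
  have h2σ : 0 < 2 * σ - 1 := by linarith
  have hq0 : 0 ≤ 1 / (2 * σ - 1) := (div_pos one_pos h2σ).le
  rcases Nat.eq_zero_or_pos M with rfl | hM
  · rw [Finset.Ioc_self, Finset.sum_empty]; linarith
  · rw [← Finset.sum_Ioc_consecutive (fun n : ℕ => (n : ℝ) ^ (-(2 * σ))) (Nat.zero_le 1) hM]
    have hI : Finset.Ioc (0 : ℕ) 1 = {1} := by ext x; simp
    have h1 : ∑ n ∈ Finset.Ioc (0 : ℕ) 1, ((n : ℕ) : ℝ) ^ (-(2 * σ)) = 1 := by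
      rw [hI, Finset.sum_singleton]; simp
    rw [h1]
    have h2 := sum_Ioc_rpow_neg_le (by linarith : 1 < 2 * σ) le_rfl M
    rw [Nat.cast_one, Real.one_rpow] at h2
    linarith

/-- **(4.22) at `σ > ½`, the tail of `ζ(2s)`**: if a finite set `S ⊆ ℕ_{>0}` contains `1, …, R`
(`R ≥ 1`) and `Re s = σ > ½`, then `‖Σ_{l∈S} (l^{−s})² − ζ(2s)‖ ≤ Σ_{l>R} l^{−2σ} ≤ R^{1−2σ}/(2σ−1)`.
(The tree's `σ ≥ ¾` version bounds the tail by `2/√R`.) [cite: BellottiPuglisi2023, §2 proof of Lemma 6 p. 10]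
[cite: Pintz1976ElementaryIII, §4 (4.22) p. 304] -/
theorem norm_sum_sq_sub_zeta_le' {s : ℂ} (hσ : 1 / 2 < s.re) {R : ℕ} (hR : 1 ≤ R)
    (S : Finset ℕ) (h0 : 0 ∉ S) (hS : ∀ n, 1 ≤ n → n ≤ R → n ∈ S) :
    ‖(∑ l ∈ S, ((l : ℂ) ^ (-s)) ^ 2) - riemannZeta (2 * s)‖ ≤
      (R : ℝ) ^ (1 - 2 * s.re) / (2 * s.re - 1) := by
  classical
  have h2re : (2 * s).re = 2 * s.re := by simp [Complex.mul_re]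
  have hre : 1 < (2 * s).re := by rw [h2re]; linarith
  set f : ℕ → ℂ := fun n => 1 / (n : ℂ) ^ (2 * s) with hf
  have hsum : Summable f := Complex.summable_one_div_nat_cpow.mpr hre
  have hzeta : riemannZeta (2 * s) = ∑' n, f n := zeta_eq_tsum_one_div_nat_cpow hre
  -- the finite sum is `Σ_{l∈S} f l`
  have hfin : (∑ l ∈ S, ((l : ℂ) ^ (-s)) ^ 2) = ∑ l ∈ S, f l := by
    refine Finset.sum_congr rfl fun l hl => ?_
    have hl0 : (l : ℂ) ≠ 0 := by
      have : l ≠ 0 := fun h => h0 (h ▸ hl)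
      exact_mod_cast this
    rw [hf]; simp only []
    rw [← Complex.cpow_nat_mul, show ((2 : ℕ) : ℂ) * -s = -(2 * s) by push_cast; ring,
      Complex.cpow_neg, one_div]
  rw [hfin, hzeta, ← hsum.sum_add_tsum_compl (s := S), sub_add_cancel_left, norm_neg]
  -- norms of the tail terms
  have hnorm : ∀ n : ℕ, ‖f n‖ = if n = 0 then 0 else (n : ℝ) ^ (-(2 * s.re)) := by
    intro n
    rcases eq_or_ne n 0 with rfl | hn
    · simp [hf, Complex.zero_cpow (by intro h; rw [h, Complex.zero_re] at hre; linarith : 2 * s ≠ 0)]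
    · rw [if_neg hn, hf]; simp only []
      rw [norm_div, norm_one, Complex.norm_natCast_cpow_of_pos (Nat.pos_of_ne_zero hn), h2re,
        Real.rpow_neg (Nat.cast_nonneg n), one_div]
  have hsum' : Summable fun x : ↥((↑S : Set ℕ)ᶜ) => ‖f x‖ := (hsum.norm).subtype _
  refine (norm_tsum_le_tsum_norm hsum').trans ?_
  refine hsum'.tsum_le_of_sum_le fun F => ?_
  -- a finite piece of the tail lies in `(R, M]`
  set G : Finset ℕ := F.map (Function.Embedding.subtype _) with hG
  have hGS : ∀ n ∈ G, n ∉ S := by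
    intro n hn
    obtain ⟨x, -, rfl⟩ := Finset.mem_map.mp hn
    exact x.2
  have hFG : ∑ x ∈ F, ‖f x‖ = ∑ n ∈ G, ‖f n‖ := by rw [hG, Finset.sum_map]; rfl
  rw [hFG]
  set M := G.sup id with hM
  calc ∑ n ∈ G, ‖f n‖ = ∑ n ∈ G, (if n = 0 then 0 else (n : ℝ) ^ (-(2 * s.re))) :=
        Finset.sum_congr rfl fun n _ => hnorm n
    _ = ∑ n ∈ G.filter (fun n => n ≠ 0), (n : ℝ) ^ (-(2 * s.re)) := by
        rw [Finset.sum_filter]; refine Finset.sum_congr rfl fun n _ => ?_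
        by_cases h : n = 0 <;> simp [h]
    _ ≤ ∑ n ∈ Ioc R M, (n : ℝ) ^ (-(2 * s.re)) := by
        refine Finset.sum_le_sum_of_subset_of_nonneg (fun n hn => ?_) fun n _ _ =>
          Real.rpow_nonneg (Nat.cast_nonneg n) _
        rw [Finset.mem_filter] at hn
        rw [Finset.mem_Ioc]
        refine ⟨?_, Finset.le_sup (f := id) hn.1⟩
        by_contra hle
        exact hGS n hn.1 (hS n (Nat.pos_of_ne_zero hn.2) (not_lt.mp hle))
    _ ≤ (R : ℝ) ^ (1 - 2 * s.re) / (2 * s.re - 1) := sum_Ioc_rpow_neg_le (by linarith) hR M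

/-- **The kernel sum is an Euler product**: for a completely multiplicative `w` (`w(1) = 1`,
`w(ab) = w(a)w(b)`) and `N ≥ D ≥ 1`, `Σ_{b ≤ N, b squarefree, p∣b ⇒ p∣D} w(b) = ∏_{p∣D} (1 + w(p))`
(copy of the tree's private `Pintz1976Deuring.sum_kernel_eq_prod`; Lemma 6's "`Σ_{h∣q} μ²(h) h^{−s}
… = ∏_{p∣q}(1 + p^{−s}) …`"). [cite: BellottiPuglisi2023, §2 proof of Lemma 6 p. 10]
[cite: Pintz1976ElementaryIII, §4 (4.21)–(4.23) p. 304] -/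
theorem sum_kernel_eq_prod' {D : ℕ} [NeZero D] {T : Type*} [CommSemiring T] (w : ℕ → T)
    (hw1 : w 1 = 1) (hw : ∀ a b, w (a * b) = w a * w b) {N : ℕ} (hN : D ≤ N) :
    ∑ b ∈ (Ioc 0 N).filter (fun b => Squarefree b ∧ ∀ p ∈ b.primeFactors, p ∣ D), w b =
      ∏ p ∈ D.primeFactors, (1 + w p) := by
  classical
  have hD0 : 0 < D := NeZero.pos D
  let W : ℕ →* T := { toFun := w, map_one' := hw1, map_mul' := hw }
  have hWprod : ∀ U : Finset ℕ, w (∏ p ∈ U, p) = ∏ p ∈ U, w p := fun U => map_prod W _ U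
  rw [Finset.prod_one_add]
  symm
  refine Finset.sum_nbij' (fun U => ∏ p ∈ U, p) (fun b => b.primeFactors) ?_ ?_ ?_ ?_ ?_
  · intro U hU
    rw [Finset.mem_powerset] at hU
    have hUp : ∀ p ∈ U, p.Prime := fun p hp => Nat.prime_of_mem_primeFactors (hU hp)
    have hdvd : (∏ p ∈ U, p) ∣ D :=
      (Finset.prod_dvd_prod_of_subset _ _ _ hU).trans (Nat.prod_primeFactors_dvd D)
    rw [Finset.mem_filter, Finset.mem_Ioc]
    refine ⟨⟨Finset.prod_pos fun p hp => (hUp p hp).pos, (Nat.le_of_dvd hD0 hdvd).trans hN⟩, ?_, ?_⟩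
    · clear hU hdvd
      induction U using Finset.induction_on with
      | empty => simp
      | insert p U hpU ih =>
        rw [Finset.prod_insert hpU]
        have hp : p.Prime := hUp p (Finset.mem_insert_self _ _)
        have hUp' : ∀ q ∈ U, q.Prime := fun q hq => hUp q (Finset.mem_insert_of_mem hq)
        have hcop : Nat.Coprime p (∏ q ∈ U, q) :=
          Nat.Coprime.prod_right fun q hq => (Nat.coprime_primes hp (hUp' q hq)).mpr
            (fun h => hpU (h ▸ hq))
        exact (Nat.squarefree_mul hcop).mpr ⟨hp.prime.squarefree, ih hUp'⟩
    · intro q hq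
      rw [Nat.primeFactors_prod hUp] at hq
      exact Nat.dvd_of_mem_primeFactors (hU hq)
  · intro b hb
    rw [Finset.mem_filter] at hb
    rw [Finset.mem_powerset]
    intro q hq
    exact Nat.mem_primeFactors.mpr ⟨Nat.prime_of_mem_primeFactors hq, hb.2.2 q hq, hD0.ne'⟩
  · intro U hU
    rw [Finset.mem_powerset] at hU
    exact Nat.primeFactors_prod fun p hp => Nat.prime_of_mem_primeFactors (hU hp)
  · intro b hb
    rw [Finset.mem_filter] at hb
    exact Nat.prod_primeFactors_of_squarefree hb.2.1
  · intro U _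
    exact (hWprod U).symm

variable {D : ℕ} (χ : DirichletCharacter ℂ D)

/-- For a real character `χ` mod `D` and a prime `p`: `Re χ(p) = 0 ⟺ p ∣ D`. [folklore] -/
private theorem reChar_prime_eq_zero_iff'' [NeZero D] (hq : χ ^ 2 = 1) {p : ℕ} (hp : p.Prime) :
    reChar χ p = 0 ↔ p ∣ D := by
  rw [reChar_apply χ hp.ne_zero]
  constructor
  · intro h0
    by_contra hnd
    have hu : IsUnit ((p : ℕ) : ZMod D) := (ZMod.isUnit_prime_iff_not_dvd hp).mpr hnd
    have hne : χ (p : ZMod D) ≠ 0 := (hu.map χ).ne_zero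
    rcases MulChar.isQuadratic_iff_sq_eq_one.mpr hq (p : ZMod D) with h | h | h
    · exact hne h
    · rw [h] at h0; norm_num at h0
    · rw [h] at h0; norm_num at h0
  · intro hdvd
    have hunit : ¬ IsUnit ((p : ℕ) : ZMod D) := by
      rw [ZMod.isUnit_prime_iff_not_dvd hp]; exact not_not.mpr hdvd
    rw [χ.map_nonunit hunit, Complex.zero_re]

/-- Norm of a term: `‖g(n) n^{−s}‖ = g(n) n^{−σ}` (`n ≥ 1`). [folklore] -/
private theorem norm_term_eq' (hq : χ ^ 2 = 1) (s : ℂ) {n : ℕ} (hn : 0 < n) :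
    ‖(charDivisorSum χ n : ℂ) * (n : ℂ) ^ (-s)‖ = charDivisorSum χ n * (n : ℝ) ^ (-s.re) := by
  rw [norm_mul, Complex.norm_real, Real.norm_eq_abs, abs_of_nonneg (charDivisorSum_nonneg χ hq n),
    Complex.norm_natCast_cpow_of_pos hn, Complex.neg_re]

end Helpers

/-! ### The chain (4.20)–(4.22) at `½ < σ ≤ 1` -/

section Chain

variable {D : ℕ} (χ : DirichletCharacter ℂ D)

/-- **Lemmas 5–6 (the multiplicative chain), uniform core.** For a quadratic `χ` mod `D`,
`½ < σ = Re s ≤ 1`, `N ≥ D`, and an integer `1 ≤ R ≤ N` below every split prime, there is `V` (the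
truncation `Σ_{l≤N, l∈R} l^{−2s}` of `ζ(2s)`) with `‖V − ζ(2s)‖ ≤ R^{1−2σ}/(2σ−1)` and
`‖Σ_{n≤N} g(n)n^{−s} − V·∏_{p∣D}(1 + p^{−s})‖ ≤ 2^{ω(D)}·((1 + 1/(2σ−1))·W + 2N^{½−σ}/(2σ−1))`,
`W = Σ_{1<a≤N, a∈A₁} g(a)a^{−σ}` ("`Σ_{n≤q} g(n)n^{−s} = Σ_{r∈R} g(r)r^{−s} + O(Σ_{r∈R} g(r)r^{−σ}
Σ_{a∈A₁,1<a≤q} g(a)a^{−σ})`", p. 9; "`Σ_{r∈R} g(r)r^{−s} = Σ_{h∣q} μ²(h)h^{−s} Σ_{r∈R,r≤√(q/h)} r^{−2s}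
= Σ_h μ²(h)h^{−s}[ζ(2s) + O(Σ_{r>R₀} r^{−1−2ℓ})] + O(Σ_h μ²(h)h^{−½−ℓ}Σ_{r>√(q/h)} r^{−1−2ℓ})`",
p. 10). [cite: BellottiPuglisi2023, §2 Lemmas 5–6 pp. 9–10]
[cite: Pintz1976ElementaryIII, §4 (4.20)–(4.23) pp. 304–305] -/
theorem chain [NeZero D] (hq : χ ^ 2 = 1) {s : ℂ} (hσ : 1 / 2 < s.re) (hσ1 : s.re ≤ 1)
    {N R : ℕ} (hN : D ≤ N) (hR : 1 ≤ R) (hRN : R ≤ N)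
    (hRsplit : ∀ p, p.Prime → reChar χ p = 1 → R < p) :
    ∃ V : ℂ, ‖V - riemannZeta (2 * s)‖ ≤ (R : ℝ) ^ (1 - 2 * s.re) / (2 * s.re - 1) ∧
      ‖(∑ n ∈ Ioc 0 N, (charDivisorSum χ n : ℂ) * (n : ℂ) ^ (-s)) -
          V * ∏ p ∈ D.primeFactors, (1 + (p : ℂ) ^ (-s))‖ ≤
        (2 : ℝ) ^ D.primeFactors.card *
          ((1 + 1 / (2 * s.re - 1)) *
              ((∑ a ∈ (Ioc 0 N).filter (fun a => ∀ p ∈ a.primeFactors, reChar χ p = 1),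
                charDivisorSum χ a * (a : ℝ) ^ (-s.re)) - 1) +
            2 * (N : ℝ) ^ (1 / 2 - s.re) / (2 * s.re - 1)) := by
  classical
  have hD0 : 0 < D := NeZero.pos D
  have hN1 : 1 ≤ N := le_trans (NeZero.one_le) hN
  have hN0 : (0 : ℝ) < N := by exact_mod_cast hN1
  set σ := s.re with hσdef
  have hσ0 : 0 < σ := by linarith
  have h2σ1 : 0 < 2 * σ - 1 := by linarith
  set Bσ : ℝ := 1 + 1 / (2 * σ - 1) with hBσ
  have hBσ0 : 0 ≤ Bσ := by positivity
  set splitSet := (Ioc 0 N).filter (fun a => ∀ p ∈ a.primeFactors, reChar χ p = 1) with hsplitSet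
  set W : ℝ := (∑ a ∈ splitSet, charDivisorSum χ a * (a : ℝ) ^ (-σ)) - 1 with hW
  set freeP : ℕ → Prop := fun r => ∀ p ∈ r.primeFactors, reChar χ p ≠ 1 with hfreeP
  set freeSet := (Ioc 0 N).filter freeP with hfreeSet
  set c : ℕ → ℂ := fun r => (charDivisorSum χ r : ℂ) * (r : ℂ) ^ (-s) with hc
  set A : ℕ → ℂ := fun r => ∑ a ∈ (Ioc 0 (N / r)).filter (fun a => ∀ p ∈ a.primeFactors, reChar χ p = 1),
    (charDivisorSum χ a : ℂ) * (a : ℂ) ^ (-s) with hA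
  set T : ℂ := ∑ n ∈ Ioc 0 N, (charDivisorSum χ n : ℂ) * (n : ℂ) ^ (-s) with hT
  set F : ℂ := ∑ r ∈ freeSet, c r with hF
  set kerSet := (Ioc 0 N).filter (fun b => Squarefree b ∧ ∀ p ∈ b.primeFactors, reChar χ p = 0)
    with hkerSet
  set Z : ℕ → ℂ := fun b => ∑ l ∈ (Ioc 0 (Nat.sqrt (N / b))).filter freeP, ((l : ℂ) ^ (-s)) ^ 2 with hZ
  set V : ℂ := ∑ l ∈ (Ioc 0 N).filter freeP, ((l : ℂ) ^ (-s)) ^ 2 with hV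
  set Pis : ℂ := ∏ p ∈ D.primeFactors, (1 + (p : ℂ) ^ (-s)) with hPis
  refine ⟨V, ?_, ?_⟩
  · -- `‖V − ζ(2s)‖ ≤ R^{1−2σ}/(2σ−1)`: `V ⊇` the terms `l ≤ R` (no split prime `≤ R`)
    refine norm_sum_sq_sub_zeta_le' hσ hR _ (by simp) fun n hn1 hnR => ?_
    rw [Finset.mem_filter, Finset.mem_Ioc]
    refine ⟨⟨hn1, hnR.trans hRN⟩, fun p hp h1 => ?_⟩
    have hpn : p ≤ n := Nat.le_of_dvd hn1 (Nat.dvd_of_mem_primeFactors hp)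
    have := hRsplit p (Nat.prime_of_mem_primeFactors hp) h1
    omega
  -- nonnegativity facts
  have hterm0 : ∀ n : ℕ, 0 ≤ charDivisorSum χ n * (n : ℝ) ^ (-σ) := fun n =>
    mul_nonneg (charDivisorSum_nonneg χ hq n) (Real.rpow_nonneg (Nat.cast_nonneg n) _)
  have h1split : 1 ∈ splitSet := by
    rw [hsplitSet, Finset.mem_filter, Finset.mem_Ioc]
    exact ⟨⟨Nat.one_pos, hN1⟩, by simp⟩
  have hW' : ∑ a ∈ splitSet.erase 1, charDivisorSum χ a * (a : ℝ) ^ (-σ) = W := by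
    rw [hW, Finset.sum_erase_eq_sub h1split]; simp
  have hW0 : 0 ≤ W := by rw [← hW']; exact Finset.sum_nonneg fun a _ => hterm0 a
  -- the kernel set and its sums
  have hkerSet' : kerSet = (Ioc 0 N).filter (fun b => Squarefree b ∧ ∀ p ∈ b.primeFactors, p ∣ D) := by
    rw [hkerSet]
    refine Finset.filter_congr fun b _ => ?_
    refine and_congr_right fun _ => forall₂_congr fun p hp => ?_
    exact reChar_prime_eq_zero_iff'' χ hq (Nat.prime_of_mem_primeFactors hp)
  have hBc : ∑ b ∈ kerSet, (b : ℂ) ^ (-s) = Pis := by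
    rw [hkerSet', hPis]
    exact sum_kernel_eq_prod' (fun n : ℕ => (n : ℂ) ^ (-s)) (by simp)
      (fun a b => by rw [Nat.cast_mul, Complex.natCast_mul_natCast_cpow]) hN
  have h2pow : ∀ τ : ℝ, 0 < τ → ∑ b ∈ kerSet, (b : ℝ) ^ (-τ) ≤ (2 : ℝ) ^ D.primeFactors.card := by
    intro τ hτ
    rw [hkerSet', sum_kernel_eq_prod' (fun n : ℕ => (n : ℝ) ^ (-τ)) (by simp)
      (fun a b => by rw [Nat.cast_mul, Real.mul_rpow (Nat.cast_nonneg a) (Nat.cast_nonneg b)]) hN,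
      ← Finset.prod_const]
    refine Finset.prod_le_prod (fun p hp => ?_) fun p hp => ?_
    · have := (prime_rpow_neg_lt_one (Nat.prime_of_mem_primeFactors hp) hτ).1; linarith
    · have := (prime_rpow_neg_lt_one (Nat.prime_of_mem_primeFactors hp) hτ).2; linarith
  have hmemker : ∀ b ∈ kerSet, 0 < b ∧ b ≤ N := fun b hb =>
    Finset.mem_Ioc.mp (Finset.mem_filter.mp hb).1
  -- `‖Z_b‖`-type bound: any sub-sum of `(l^{-s})²` over `l ≤ M` has norm `≤ Bσ`
  have hsqnorm : ∀ (l : ℕ), 0 < l → ‖((l : ℂ) ^ (-s)) ^ 2‖ = (l : ℝ) ^ (-(2 * σ)) := by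
    intro l hl
    rw [norm_pow, Complex.norm_natCast_cpow_of_pos hl, Complex.neg_re, ← hσdef, ← Real.rpow_natCast,
      ← Real.rpow_mul (Nat.cast_nonneg l)]
    congr 1; push_cast; ring
  -- (i) `Σ_{free r ≤ N} g(r) r^{−σ} ≤ 2^ω Bσ` via (4.21) at the real point `σ`
  have hfree : ∑ r ∈ freeSet, charDivisorSum χ r * (r : ℝ) ^ (-σ) ≤ (2 : ℝ) ^ D.primeFactors.card * Bσ := by
    have h421r : (∑ r ∈ freeSet, (charDivisorSum χ r : ℂ) * (r : ℂ) ^ (-(σ : ℂ))) =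
        ∑ b ∈ kerSet, (b : ℂ) ^ (-(σ : ℂ)) *
          ∑ l ∈ (Ioc 0 (Nat.sqrt (N / b))).filter freeP, ((l : ℂ) ^ (-(σ : ℂ))) ^ 2 :=
      sum_free_eq_sum_kernel_mul_sum_sq χ hq (σ : ℂ) N
    -- the left side is the real sum, cast
    have hcast : ∑ r ∈ freeSet, (charDivisorSum χ r : ℂ) * (r : ℂ) ^ (-(σ : ℂ)) =
        ((∑ r ∈ freeSet, charDivisorSum χ r * (r : ℝ) ^ (-σ) : ℝ) : ℂ) := by
      rw [Complex.ofReal_sum]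
      refine Finset.sum_congr rfl fun r _ => ?_
      rw [Complex.ofReal_mul, show (-(σ : ℂ)) = ((-σ : ℝ) : ℂ) by push_cast; ring,
        ← Complex.ofReal_natCast, ← Complex.ofReal_cpow (Nat.cast_nonneg r)]
    have hσre : ((σ : ℂ)).re = σ := Complex.ofReal_re σ
    have hnn : 0 ≤ ∑ r ∈ freeSet, charDivisorSum χ r * (r : ℝ) ^ (-σ) := Finset.sum_nonneg fun r _ => hterm0 r
    calc ∑ r ∈ freeSet, charDivisorSum χ r * (r : ℝ) ^ (-σ)
        = ‖((∑ r ∈ freeSet, charDivisorSum χ r * (r : ℝ) ^ (-σ) : ℝ) : ℂ)‖ := by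
          rw [Complex.norm_real, Real.norm_eq_abs, abs_of_nonneg hnn]
      _ = ‖∑ b ∈ kerSet, (b : ℂ) ^ (-(σ : ℂ)) *
            ∑ l ∈ (Ioc 0 (Nat.sqrt (N / b))).filter freeP, ((l : ℂ) ^ (-(σ : ℂ))) ^ 2‖ := by
          rw [← hcast, h421r]
      _ ≤ ∑ b ∈ kerSet, ‖(b : ℂ) ^ (-(σ : ℂ)) *
            ∑ l ∈ (Ioc 0 (Nat.sqrt (N / b))).filter freeP, ((l : ℂ) ^ (-(σ : ℂ))) ^ 2‖ := norm_sum_le _ _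
      _ ≤ ∑ b ∈ kerSet, (b : ℝ) ^ (-σ) * Bσ := by
          refine Finset.sum_le_sum fun b hb => ?_
          have hb0 := (hmemker b hb).1
          rw [norm_mul, Complex.norm_natCast_cpow_of_pos hb0, Complex.neg_re, hσre]
          refine mul_le_mul_of_nonneg_left ?_ (Real.rpow_nonneg (Nat.cast_nonneg b) _)
          -- the inner bound at the real point: same computation with `s := σ`
          calc ‖∑ l ∈ (Ioc 0 (Nat.sqrt (N / b))).filter freeP, ((l : ℂ) ^ (-(σ : ℂ))) ^ 2‖
              ≤ ∑ l ∈ (Ioc 0 (Nat.sqrt (N / b))).filter freeP, ‖((l : ℂ) ^ (-(σ : ℂ))) ^ 2‖ :=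
                norm_sum_le _ _
            _ ≤ ∑ l ∈ Ioc 0 (Nat.sqrt (N / b)), ‖((l : ℂ) ^ (-(σ : ℂ))) ^ 2‖ :=
                Finset.sum_le_sum_of_subset_of_nonneg (Finset.filter_subset _ _) fun _ _ _ => norm_nonneg _
            _ = ∑ l ∈ Ioc 0 (Nat.sqrt (N / b)), (l : ℝ) ^ (-(2 * σ)) := by
                refine Finset.sum_congr rfl fun l hl => ?_
                have hl0 := (Finset.mem_Ioc.mp hl).1
                rw [norm_pow, Complex.norm_natCast_cpow_of_pos hl0, Complex.neg_re, hσre,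
                  ← Real.rpow_natCast, ← Real.rpow_mul (Nat.cast_nonneg l)]
                congr 1; push_cast; ring
            _ ≤ Bσ := sum_Ioc_zero_rpow_neg_le hσ _
      _ = (∑ b ∈ kerSet, (b : ℝ) ^ (-σ)) * Bσ := by rw [Finset.sum_mul]
      _ ≤ (2 : ℝ) ^ D.primeFactors.card * Bσ := mul_le_mul_of_nonneg_right (h2pow σ hσ0) hBσ0
  -- (ii) (4.20): `T = Σ_{r free} c(r) A(r)` and `‖A(r) − 1‖ ≤ W`
  have h420 : T = ∑ r ∈ freeSet, c r * A r := sum_eq_sum_free_mul_sum_split χ hq s N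
  have hA1 : ∀ r ∈ freeSet, ‖A r - 1‖ ≤ W := by
    intro r hr
    obtain ⟨hr0, hrN⟩ := Finset.mem_Ioc.mp (Finset.mem_filter.mp hr).1
    have hNr : 1 ≤ N / r := (Nat.le_div_iff_mul_le hr0).mpr (by simpa using hrN)
    set Sr := (Ioc 0 (N / r)).filter (fun a => ∀ p ∈ a.primeFactors, reChar χ p = 1) with hSr
    have h1Sr : 1 ∈ Sr := by
      rw [hSr, Finset.mem_filter, Finset.mem_Ioc]; exact ⟨⟨Nat.one_pos, hNr⟩, by simp⟩
    have hsub : Sr.erase 1 ⊆ splitSet.erase 1 := by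
      refine Finset.erase_subset_erase _ fun a ha => ?_
      rw [hSr, Finset.mem_filter, Finset.mem_Ioc] at ha
      rw [hsplitSet, Finset.mem_filter, Finset.mem_Ioc]
      exact ⟨⟨ha.1.1, ha.1.2.trans (Nat.div_le_self _ _)⟩, ha.2⟩
    have hAr : A r - 1 = ∑ a ∈ Sr.erase 1, (charDivisorSum χ a : ℂ) * (a : ℂ) ^ (-s) := by
      rw [Finset.sum_erase_eq_sub h1Sr]; simp [hA, hSr]
    rw [hAr]
    calc ‖∑ a ∈ Sr.erase 1, (charDivisorSum χ a : ℂ) * (a : ℂ) ^ (-s)‖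
        ≤ ∑ a ∈ Sr.erase 1, ‖(charDivisorSum χ a : ℂ) * (a : ℂ) ^ (-s)‖ := norm_sum_le _ _
      _ = ∑ a ∈ Sr.erase 1, charDivisorSum χ a * (a : ℝ) ^ (-σ) := by
          refine Finset.sum_congr rfl fun a ha => ?_
          have ha0 : 0 < a := (Finset.mem_Ioc.mp (Finset.mem_filter.mp (Finset.mem_of_mem_erase ha)).1).1
          exact norm_term_eq' χ hq s ha0
      _ ≤ ∑ a ∈ splitSet.erase 1, charDivisorSum χ a * (a : ℝ) ^ (-σ) :=
          Finset.sum_le_sum_of_subset_of_nonneg hsub fun a _ _ => hterm0 a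
      _ = W := hW'
  have hTF : ‖T - F‖ ≤ (2 : ℝ) ^ D.primeFactors.card * Bσ * W := by
    have hdiff : T - F = ∑ r ∈ freeSet, c r * (A r - 1) := by
      rw [h420, hF, ← Finset.sum_sub_distrib]
      refine Finset.sum_congr rfl fun r _ => by ring
    rw [hdiff]
    calc ‖∑ r ∈ freeSet, c r * (A r - 1)‖ ≤ ∑ r ∈ freeSet, ‖c r * (A r - 1)‖ := norm_sum_le _ _
      _ ≤ ∑ r ∈ freeSet, charDivisorSum χ r * (r : ℝ) ^ (-σ) * W := by
          refine Finset.sum_le_sum fun r hr => ?_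
          have hr0 : 0 < r := (Finset.mem_Ioc.mp (Finset.mem_filter.mp hr).1).1
          rw [norm_mul, hc]; simp only []
          rw [norm_term_eq' χ hq s hr0]
          exact mul_le_mul_of_nonneg_left (hA1 r hr) (hterm0 r)
      _ = (∑ r ∈ freeSet, charDivisorSum χ r * (r : ℝ) ^ (-σ)) * W := by rw [Finset.sum_mul]
      _ ≤ ((2 : ℝ) ^ D.primeFactors.card * Bσ) * W := mul_le_mul_of_nonneg_right hfree hW0
  -- (iii) (4.21): `F = Σ_b b^{-s} Z_b`, and `‖Z_b − V‖ ≤ M_b^{1−2σ}/(2σ−1) ≤ 2^{2σ−1} b^{σ−½} N^{½−σ}/(2σ−1)`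
  have h421 : F = ∑ b ∈ kerSet, (b : ℂ) ^ (-s) * Z b := sum_free_eq_sum_kernel_mul_sum_sq χ hq s N
  have hZV : ∀ b ∈ kerSet, (b : ℝ) ^ (-σ) * ‖Z b - V‖ ≤
      2 * (b : ℝ) ^ (-(1 / 2 : ℝ)) * (N : ℝ) ^ (1 / 2 - σ) / (2 * σ - 1) := by
    intro b hb
    obtain ⟨hb0, hbN⟩ := hmemker b hb
    have hb0r : (0 : ℝ) < b := by exact_mod_cast hb0
    set M : ℕ := Nat.sqrt (N / b) with hM
    have hNb1 : 1 ≤ N / b := (Nat.le_div_iff_mul_le hb0).mpr (by simpa using hbN)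
    have hM1 : 1 ≤ M := by rw [hM, Nat.le_sqrt]; simpa using hNb1
    have hMN : M ≤ N := by
      calc M ≤ N / b := Nat.sqrt_le_self _
        _ ≤ N := Nat.div_le_self _ _
    -- `V − Z_b = Σ_{M < l ≤ N, free} (l^{-s})²`
    have hsplit : V - Z b = ∑ l ∈ (Ioc M N).filter freeP, ((l : ℂ) ^ (-s)) ^ 2 := by
      rw [hV, hZ]; simp only []
      rw [Finset.sum_filter, Finset.sum_filter, Finset.sum_filter,
        ← Finset.sum_Ioc_consecutive (fun l : ℕ => if freeP l then ((l : ℂ) ^ (-s)) ^ 2 else 0)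
          (Nat.zero_le M) hMN]
      ring
    have hnormVZ : ‖Z b - V‖ ≤ (M : ℝ) ^ (1 - 2 * σ) / (2 * σ - 1) := by
      rw [norm_sub_rev, hsplit]
      calc ‖∑ l ∈ (Ioc M N).filter freeP, ((l : ℂ) ^ (-s)) ^ 2‖
          ≤ ∑ l ∈ (Ioc M N).filter freeP, ‖((l : ℂ) ^ (-s)) ^ 2‖ := norm_sum_le _ _
        _ ≤ ∑ l ∈ Ioc M N, ‖((l : ℂ) ^ (-s)) ^ 2‖ :=
            Finset.sum_le_sum_of_subset_of_nonneg (Finset.filter_subset _ _) fun _ _ _ => norm_nonneg _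
        _ = ∑ l ∈ Ioc M N, (l : ℝ) ^ (-(2 * σ)) :=
            Finset.sum_congr rfl fun l hl => hsqnorm l (lt_of_le_of_lt (Nat.zero_le M) (Finset.mem_Ioc.mp hl).1)
        _ ≤ (M : ℝ) ^ (1 - 2 * σ) / (2 * σ - 1) := sum_Ioc_rpow_neg_le (by linarith) hM1 N
    -- `M ≥ √(N/b)/2`: `(2M)² ≥ N/b`
    have hM0r : (0 : ℝ) < M := by exact_mod_cast hM1
    have h2M : (N : ℝ) / b ≤ ((2 * M : ℕ) : ℝ) ^ 2 := by
      have h1 : N / b < (M + 1) ^ 2 := by rw [hM]; exact Nat.lt_succ_sqrt' (N / b)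
      have h2 : (M + 1) ^ 2 ≤ (2 * M) ^ 2 := Nat.pow_le_pow_left (by omega) 2
      have h3 : N / b + 1 ≤ (2 * M) ^ 2 := by omega
      have h4 : (N : ℝ) / b < (N / b : ℕ) + 1 := by
        have := Nat.lt_div_mul_add (a := N) hb0
        rw [div_lt_iff₀ hb0r]
        calc (N : ℝ) < ((N / b * b + b : ℕ) : ℝ) := by exact_mod_cast this
          _ = ((N / b : ℕ) + 1 : ℝ) * b := by push_cast; ring
      have h5 : ((N / b : ℕ) : ℝ) + 1 ≤ ((2 * M : ℕ) : ℝ) ^ 2 := by exact_mod_cast h3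
      linarith
    -- hence `M^{1−2σ} ≤ 2^{2σ−1} (N/b)^{½−σ} ≤ 2 (N/b)^{½−σ}`
    have hexp_nonpos : (1 - 2 * σ) / 2 ≤ 0 := by linarith
    have hMpow : (M : ℝ) ^ (1 - 2 * σ) ≤ 2 * ((N : ℝ) / b) ^ (1 / 2 - σ) := by
      have hNb0 : 0 < (N : ℝ) / b := by positivity
      -- `((2M)²)^{(1−2σ)/2} ≤ (N/b)^{(1−2σ)/2}`
      have h1 : (((2 * M : ℕ) : ℝ) ^ 2) ^ ((1 - 2 * σ) / 2) ≤ ((N : ℝ) / b) ^ ((1 - 2 * σ) / 2) :=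
        Real.rpow_le_rpow_of_nonpos hNb0 h2M hexp_nonpos
      have h2 : (((2 * M : ℕ) : ℝ) ^ 2) ^ ((1 - 2 * σ) / 2) = (2 : ℝ) ^ (1 - 2 * σ) * (M : ℝ) ^ (1 - 2 * σ) := by
        rw [← Real.rpow_natCast, ← Real.rpow_mul (by positivity), show ((2 : ℕ) : ℝ) * ((1 - 2 * σ) / 2) =
          1 - 2 * σ by push_cast; ring]
        push_cast
        rw [Real.mul_rpow (by norm_num) hM0r.le]
      have h3 : ((N : ℝ) / b) ^ ((1 - 2 * σ) / 2) = ((N : ℝ) / b) ^ (1 / 2 - σ) := by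
        congr 1; ring
      rw [h2, h3] at h1
      -- divide by `2^{1−2σ} ≥ 1/2`
      have h4 : (1 / 2 : ℝ) ≤ (2 : ℝ) ^ (1 - 2 * σ) := by
        calc (1 / 2 : ℝ) = (2 : ℝ) ^ (-(1 : ℝ)) := by rw [Real.rpow_neg_one]; norm_num
          _ ≤ (2 : ℝ) ^ (1 - 2 * σ) := Real.rpow_le_rpow_of_exponent_le (by norm_num) (by linarith)
      have h5 : 0 ≤ (M : ℝ) ^ (1 - 2 * σ) := Real.rpow_nonneg hM0r.le _
      have h6 : 0 ≤ ((N : ℝ) / b) ^ (1 / 2 - σ) := Real.rpow_nonneg hNb0.le _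
      nlinarith [mul_le_mul_of_nonneg_right h4 h5]
    -- assemble: `b^{-σ} (N/b)^{½−σ} = b^{-1/2} N^{½−σ}`
    have hsplitpow : (b : ℝ) ^ (-σ) * ((N : ℝ) / b) ^ (1 / 2 - σ) =
        (b : ℝ) ^ (-(1 / 2 : ℝ)) * (N : ℝ) ^ (1 / 2 - σ) := by
      have key : (b : ℝ) ^ (-(1 / 2 : ℝ)) * (b : ℝ) ^ (1 / 2 - σ) = (b : ℝ) ^ (-σ) := by
        rw [← Real.rpow_add hb0r]; congr 1; ring
      have hbe : (b : ℝ) ^ (1 / 2 - σ) ≠ 0 := (Real.rpow_pos_of_pos hb0r _).ne'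
      rw [Real.div_rpow hN0.le hb0r.le, ← key]
      field_simp
    calc (b : ℝ) ^ (-σ) * ‖Z b - V‖ ≤ (b : ℝ) ^ (-σ) * ((M : ℝ) ^ (1 - 2 * σ) / (2 * σ - 1)) :=
          mul_le_mul_of_nonneg_left hnormVZ (Real.rpow_nonneg hb0r.le _)
      _ ≤ (b : ℝ) ^ (-σ) * (2 * ((N : ℝ) / b) ^ (1 / 2 - σ) / (2 * σ - 1)) :=
          mul_le_mul_of_nonneg_left (div_le_div_of_nonneg_right hMpow h2σ1.le)
            (Real.rpow_nonneg hb0r.le _)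
      _ = 2 * ((b : ℝ) ^ (-σ) * ((N : ℝ) / b) ^ (1 / 2 - σ)) / (2 * σ - 1) := by ring
      _ = 2 * (b : ℝ) ^ (-(1 / 2 : ℝ)) * (N : ℝ) ^ (1 / 2 - σ) / (2 * σ - 1) := by
          rw [hsplitpow]; ring
  have hFV : ‖F - V * Pis‖ ≤ (2 : ℝ) ^ D.primeFactors.card * (2 * (N : ℝ) ^ (1 / 2 - σ) / (2 * σ - 1)) := by
    have hdiff : F - V * Pis = ∑ b ∈ kerSet, (b : ℂ) ^ (-s) * (Z b - V) := by
      rw [h421, ← hBc, Finset.mul_sum, ← Finset.sum_sub_distrib]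
      refine Finset.sum_congr rfl fun b _ => by ring
    rw [hdiff]
    calc ‖∑ b ∈ kerSet, (b : ℂ) ^ (-s) * (Z b - V)‖
        ≤ ∑ b ∈ kerSet, ‖(b : ℂ) ^ (-s) * (Z b - V)‖ := norm_sum_le _ _
      _ ≤ ∑ b ∈ kerSet, 2 * (b : ℝ) ^ (-(1 / 2 : ℝ)) * (N : ℝ) ^ (1 / 2 - σ) / (2 * σ - 1) := by
          refine Finset.sum_le_sum fun b hb => ?_
          have hb0 := (hmemker b hb).1
          rw [norm_mul, Complex.norm_natCast_cpow_of_pos hb0, Complex.neg_re]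
          exact hZV b hb
      _ = (∑ b ∈ kerSet, (b : ℝ) ^ (-(1 / 2 : ℝ))) * (2 * (N : ℝ) ^ (1 / 2 - σ) / (2 * σ - 1)) := by
          rw [Finset.sum_mul]; refine Finset.sum_congr rfl fun b _ => by ring
      _ ≤ (2 : ℝ) ^ D.primeFactors.card * (2 * (N : ℝ) ^ (1 / 2 - σ) / (2 * σ - 1)) :=
          mul_le_mul_of_nonneg_right (h2pow (1 / 2) (by norm_num))
            (div_nonneg (by positivity) h2σ1.le)
  -- combine
  calc ‖T - V * Pis‖ = ‖(T - F) + (F - V * Pis)‖ := by congr 1; ring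
    _ ≤ ‖T - F‖ + ‖F - V * Pis‖ := norm_add_le _ _
    _ ≤ (2 : ℝ) ^ D.primeFactors.card * Bσ * W +
        (2 : ℝ) ^ D.primeFactors.card * (2 * (N : ℝ) ^ (1 / 2 - σ) / (2 * σ - 1)) := add_le_add hTF hFV
    _ = (2 : ℝ) ^ D.primeFactors.card * (Bσ * W + 2 * (N : ℝ) ^ (1 / 2 - σ) / (2 * σ - 1)) := by ring

end Chain

end BellottiPuglisi2023

end Literature.NumberTheory.LFunctions

end
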